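import Summits.Ventures.PercRepro.MSTightConjTBeta
import Summits.Ventures.PercRepro.MSTightConjTSingleton

/-!
# Conjecture (T) from «a half is tight» and «a tight half with two partnerless members has
its addable part among the partner members»

Dossier proofs/MINE1-theoremS.md, Addendum 46 §5 (b) and Addendum 48 §6. At a genuine tight
twin-free trace of an excess-one family with a nonempty partner family, Conjecture (T) follows
from the two census-true statements
* **L1**: `F₀` or `F₁` is tight (0 violations on 94.7 M tightening pairs of [6], Addendum 48), and
* **L2′**: a tight half with at least two partnerless members has `R*(half) ∈ K`
  (0 violations on the same scopes),
by the gen-23 theorems: a tight half with `R* ∈ K` gives `Y ⊆ X`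
(`diffsY_subset_diffsX_of_tight_half`, p447925), and a half with at most one partnerless member
gives `Y ⊆ X` by the singleton theorems (`diffsY_subset_diffsX_of_part0_subsingleton`,
`diffsY_subset_diffsX_of_partr_subsingleton`, p449345). The hypotheses `hsupp`, `hS`, `hcore`,
`hE` are the genuineness of the trace (full support, `S′ ∉ P`, empty core, `∅ ∉ P`) used by the
singleton theorems.
-/

namespace PercRepro.MSTight

open Finset
open scoped FinsetFamily

variable {α : Type*} [DecidableEq α] [Fintype α] {r : α} {F : Finset (Finset α)}

omit [Fintype α] in
/-- A family with at most one element is pairwise constant (the form of the singleton theorems'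
hypothesis). -/
theorem eq_of_card_sdiff_le_one {A B : Finset (Finset α)} (h : (A \ B).card ≤ 1) :
    ∀ s ∈ A, s ∉ B → ∀ s' ∈ A, s' ∉ B → s = s' := by
  intro s hs hsB s' hs' hs'B
  exact card_le_one.1 h s (mem_sdiff.2 ⟨hs, hsB⟩) s' (mem_sdiff.2 ⟨hs', hs'B⟩)

/-- **Conjecture (T) from L1 and L2′.** Excess one, genuine tight twin-free trace, nonempty partner
family; if some half is tight (L1) and every tight half with at least two partnerless members has
its addable part among the partner members (L2′), then `Y ⊆ X`. -/
theorem diffsY_subset_diffsX_of_tight_half_of_Rstar (hF : (F \\ F).card = F.card + 1)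
    (hP : Tight (proj r F)) (htf : ∀ a b, Twin (proj r F) a b → a = b)
    (hK : (partner r F).Nonempty)
    (hsupp : ∀ a, a ≠ r → ∃ p ∈ proj r F, a ∈ p) (hS : univ.erase r ∉ proj r F)
    (hcore : ∀ a, ∃ p ∈ proj r F, a ∉ p) (hE : (∅ : Finset α) ∉ proj r F)
    (hL1 : Tight (part0 r F) ∨ Tight (partr r F))
    (hL2₀ : Tight (part0 r F) → 2 ≤ (part0 r F \ partr r F).card →
      Rstar (part0 r F) ∈ partner r F)
    (hL2₁ : Tight (partr r F) → 2 ≤ (partr r F \ part0 r F).card →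
      Rstar (partr r F) ∈ partner r F) :
    diffsY r F ⊆ diffsX r F := by
  rcases hL1 with h0 | h1
  · by_cases hc : 2 ≤ (part0 r F \ partr r F).card
    · exact diffsY_subset_diffsX_of_tight_half hF hP htf hK (Or.inl ⟨h0, hL2₀ h0 hc⟩)
    · exact diffsY_subset_diffsX_of_part0_subsingleton hP htf hsupp hS
        (eq_of_card_sdiff_le_one (by omega))
  · by_cases hc : 2 ≤ (partr r F \ part0 r F).card
    · exact diffsY_subset_diffsX_of_tight_half hF hP htf hK (Or.inr ⟨h1, hL2₁ h1 hc⟩)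
    · exact diffsY_subset_diffsX_of_partr_subsingleton hP htf hcore hE
        (eq_of_card_sdiff_le_one (by omega))

end PercRepro.MSTight
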